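import Mathlib
import HarnessLib
import HarnessLib.Audit
import Summits.Langlands.Statement

/-!
Route: EisensteinDefectOne

CLOSED (retired) 2026-08-15T13:48:41Z by operator:999:1257524 — reason: not-a-thesis: assembly does not conclude the sub-problem Statement — note: D-0027 §2.1 audit (human 2026-08-15: routes that do not decide the summit are removed): the assembly concludes `ReducibleOrdinaryModular`, not the sub-problem statement; a NEW conforming route may be opened from the same idea (generated `closes : … → _root_.Langlands`).. The file is kept as the record of this route; refuted decls are indexed as negative knowledge (`ledger negatives`).

Route EisensteinDefectOne — realises idea card Langlands/Langlands/eisenstein-defect-one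
(Skinner–Wiles at defect one).

THESIS X ("it suffices to show X" for the sector this route serves) = `ReducibleOrdinaryModular`:
for every imaginary quadratic field F, every odd prime p and ι : ℚ̄_p ≃ ℂ, every continuous
irreducible
ρ : Γ_F → GL₂(ℚ̄_p), unramified at almost all places, which is RESIDUALLY REDUCIBLE — an integral
model
ρ₀ : Γ_F → GL₂(𝒪_{ℚ̄_p}) of ρ is upper triangular modulo the maximal ideal 𝔪, i.e. ρ̄^ss = χ̄₁ ⊕ χ̄₂
— and at
every place v ∣ p is p-DISTINGUISHED (χ̄₁|_{D_v} ≠ χ̄₂|_{D_v}) and ORDINARY OF REGULAR WEIGHT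
(ρ|_{D_v} ≅ (θ₁ ε^{k-1} ∗ ; 0 θ₂), θ₁, θ₂ of finite order on inertia, k ≥ 2), is MODULAR: there is
an
L-algebraic cuspidal automorphic representation π of GL₂(𝔸_F) whose Satake parameters give the
characteristic
polynomial of ρ(Frob_v) at almost all v (the Satake form of direction (B), exactly as in
`Literature.NumberTheory.Automorphic.FontaineMazurLanglandsGLn`; local–global compatibility at the
remaining
places — the `Corresponds` clause of `Summit.Langlands.GaloisToAutomorphic 2` — is deferred glue
shared with every
(B)-route and is not claimed here).

This is the residually-reducible ordinary sector of (B) for n = 2 over imaginary quadratic fields: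
disjoint from
every big-image automorphy-lifting theorem over CM fields (ACCGHLNSTT2023, Caraiani–Newton
arXiv:2301.10509,
defect l₀ = `Literature.Barriers.Langlands.defectGL 0 1 2` = 1) and from every residually-reducible
theorem
(Skinner–Wiles 1999, Thorne 2015, Allen–Newton–Thorne 2020, Pan 2022, X. Zhang 2024–25: all defect
zero or
polarizable). Headline instance (support item `FiveIsogenyEllipticCurves`): every non-CM elliptic
curve over an
imaginary quadratic F with an F-rational 5-isogeny and good ordinary reduction above 5 is modular —
the population
(infinite exactly when rk X₀(15)(F) > 0) that Caraiani–Newton's "X₀(15)(F) finite" hypothesis must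
omit.

Lean (one line, elaborates in the gate header environment; every constant exists: FramedGaloisRep,
FramedGaloisRep.toLocal/IsUnramifiedAt/HasFrobCharpolyAt, absInertia, absGaloisRestrict,
GaloisRep.cyclotomicCharacter,
CuspidalAutomorphicRepData, AutomorphicRepData.IsLAlgebraic/HasSatakeParamAt, arithFrobPolyOfSatake,
isCompact_glFiniteIntegralLevel, Mathlib's ValuationSubring/Valued/PadicAlgCl/IsTotallyComplex):
see decl `ReducibleOrdinaryModular` (target, rank 0). Frame: Assembly = EisensteinCongruenceSeed →
DefectOneSkinnerWiles → ReducibleOrdinaryModular (checked provable in the planner's Sketch.lean by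
forgetting the
seed's level control; the two cruxes are each strictly weaker than X and jointly give X).

Rationale: WHY THIS LINE. Every positive-defect lifting theorem over CM fields (ACCGHLNSTT2023,
arXiv:2301.10509) needs ρ̄ with
enormous image; the residually reducible technology (SkinnerWiles1999: shrink the reducible locus
over the Iwasawa
algebra, pro-modular "nice" dimension-one primes, patch deformation rings relative to the
irreducible ρ_𝔭, Raynaud
connectivity) exists only in defect zero (Pan2022, AllenNewtonThorne2020, X. Zhang
arXiv:2411.18661/2512.21249).
The card's bet: run Skinner–Wiles' nice-prime patching INSIDE Calegari–Geraghty/Hansen two-term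
complexes
(CalegariGeraghty2017 §§5,8, Hansen2012, KhareThorne2017) over the 3-dimensional Iwasawa algebra of
F, with
Caraiani–Newton's P-ordinary torsion Hida theory (arXiv:2301.10509 §§2–3, Scholze2015) as the Hecke
side and
Berger–Klosin's Bianchi Eisenstein congruences (arXiv:0801.0091, arXiv:1103.5100,
doi:10.1112/S0010437X09003984)
as the pro-modularity seed. Imported areas: Iwasawa theory of imaginary quadratic fields
(two-variable main
conjecture is available there, replacing Washington's theorem in SW), Eisenstein cohomology of
Bianchi groups.
Reducibility is converted from obstruction to entrance: Eisenstein classes exist at every level, so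
no Serre-type
residual automorphy input is needed. No spectral/probabilistic/physical catalogue item applies; this
is arithmetic.
RANKED CRUXES (typed, elaborate; each strictly weaker than X, jointly ⇒ X):
 rank 2 `DefectOneSkinnerWiles` (the engine = card Z1+Z3+Z4): IF the residual pair (χ̄₁,χ̄₂) of ρ is
realised by
   some p-ordinary regular-weight cuspidal π₀ of GL₂(𝔸_F) (an "Eisenstein congruence seed", any
level) THEN ρ is
   modular. Why it might fail: TW primes at the nice prime are short by l₀ = 1; the reducible locus
may have full
   dimension with no solvable base change available to shrink it (CalegariGeraghty2017 Rem. 5.14;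
Berger–Klosin's
   F[[X]]-valued reducible deformations); classical points are sparse on Bianchi ordinary families
(Calegari–Mazur
   JIMJ 8 (2009)), so propagation must pass through torsion/pro-modularity, i.e. CN's P-ordinary
determinants.
 rank 3 `EisensteinCongruenceSeed` (the entrance = card Z2, level-controlled so that it is NOT
implied by X): every
   such residual pair is realised by an irreducible p-ordinary cuspidal π₀ unramified, away from p
and ONE auxiliary
   place q, wherever χ̄₁ and χ̄₂ are (optimal level up to one level-raising prime). Why it might
fail: the
   congruence module is an algebraic Hecke L-value of F times (Nq − 1)-type factors; Berger's
theorem needs p split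
   and p ∤ h_F·#torsion; Eisenstein level raising with torsion classes over F is not established.
 support `FiveIsogenyEllipticCurves` (rank 9): X ⇒ the headline (p = 5: p-distinguishedness is
automatic since
   e(F_v/ℚ₅) ≤ 2 < 4 forces ω|_{I_v} ≠ 1). Glue through Tate-module facts (Faltings irreducibility,
ordinary
   filtration from good ordinary reduction, isogeny ⇒ reducible lattice).
KILL CRITERIA. A counterexample to `DefectOneSkinnerWiles` as typed (an admissible ρ with a seed but
no π) refutes
Fontaine–Mazur in this sector and closes the route `refuted`. Refuting `EisensteinCongruenceSeed` (a
residual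
pair with no level-controlled ordinary cuspidal realisation) does NOT kill the line but forces the
torsion form of
the seed (pro-modularity of the Eisenstein point in CN's P-ordinary Hecke algebra) — restate, do not
close. The
card's cheap falsifiers stay with refuters: (a) class-group data making dim R^red ≥ dim of the
ordinary components
for the smallest (F, 5, χ̄ from a 15-isogeny); (b) Berger's divisibility excluding p ∈ {3,5} for all
target F.
DELIBERATELY NOT DECOMPOSED (tenure, after a crux moves or the definitions land): the planned glued
split of
`DefectOneSkinnerWiles` into Z3 SmallReducibleLocus → Z2 ProModularNicePrimes → Z1
DefectOnePatchingAtNicePrime,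
which needs the requested definitions (nearly-ordinary deformation ring of a residual extension over
Λ_F; P-ordinary
Bianchi Hecke algebra with its Eisenstein maximal ideal; pro-modularity) and cite facts (Berger 2009
congruence
theorem; Caraiani–Newton P-ordinary determinants + local–global compatibility; Hida/CN control for
GL₂/F). Also
deferred: the p = 3 corollary (needs ζ₃ ∉ F_v), the 2-adic door, and the upgrade Satake-matching ⇒
`Corresponds`.
NOVELTY/BARRIERS: see the route's Novelty and Barriers fields (card audit 2026-08-15 by
refuter-novelty-audit-Langlands-Langlands-5-0 + planner; lit searchd unavailable at open, re-run
due).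

Novelty: DELTA (what no source states): no source runs Skinner–Wiles' patching-at-a-nice-prime INSIDE a
Calegari–Geraghty complex over the Iwasawa algebra of an imaginary quadratic field (defect one,
non-polarizable ρ, residually reducible), with Caraiani–Newton's P-ordinary torsion determinants as
the Hecke side and Bianchi Eisenstein congruences as the seed; the typed statements
`DefectOneSkinnerWiles` (seed-conditional lifting) and `EisensteinCongruenceSeed` (level-controlled
Eisenstein congruence) isolate exactly the two halves no paper states, and
`FiveIsogenyEllipticCurves` identifies the unclaimed population (15- /5-isogenous curves over F with
rk X₀(15)(F) > 0). Expected grade: new-combination (card graded new-combination).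
NEAREST PRIOR ART — Nearest prior art (searched; the card's audit by
refuter-novelty-audit-Langlands-Langlands-5-0 on 2026-08-15 read the intros; planner re-checked the
barrier files' excerpts; lit searchd was down at open time, to be re-run): SkinnerWiles1999
(doi:10.1007/bf02698855) — the method (nice primes, patching deformation rings, Iwasawa control of
the reducible locus), defect zero, ℚ / totally real; Pan2022 (doi:10.1090/jams/991) and X. Zhang
arXiv:2411.18661, arXiv:2512.21249 — SW nice primes married to patched completed cohomology, GL₂/ℚ
and totally real, defect zero; Thorne JAMS 28 (2015) doi:10.1090/S0894-0347-2014-00812-2 and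
AllenNewtonThorne2020 — residually reducible but POLARIZABLE ρ over CM fields via unitary groups
(defect zero); Berger–  [refs: 10.1007/bf02698855, 10.1090/jams/991, 10.1090/S0894-0347-2014-00812-2, 10.1112/S0010437X09003984, 10.1112/S0010437X09003984`, 10.1007/bf02698855`, 10.1017/s1474748009000036, 10.1007/s00208-010-0540-4, 10.1007/s00208-012-0793-1, 10.1093/imrn/rnu266, 10.1142/s1793042125500228, 10.1016/j.jnt.2025.04.008, 2411.18661, 2512.21249, 0801.0091, 1103.5100, 2301.10509, 1606.06535, 1907.08700, doi:10.1007/bf0]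

Barriers (technique_class: automorphy-lifting patching hida-theory eisenstein-ideal): technique_class: automorphy-lifting patching hida-theory eisenstein-ideal
- Literature.Barriers.Langlands.ResiduallyReducibleBarrier: this is the barrier attacked.
`TaylorWilesImageHypotheses` fail for ρ̄ (decomposable semisimplification), so the route never
chooses Taylor–Wiles primes relative to ρ̄: it uses the barrier's recorded evasion (a)
(SkinnerWiles1999: deform a fixed residual EXTENSION / pseudo-character so Mazur's
`CentralizerIsScalars` issue is moot, control the reducible locus by Iwasawa theory, and patch
relative to a dimension-one "nice" prime 𝔭 where ρ_𝔭 IS absolutely irreducible and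
`AdjointInvariantsTrivial` holds over k((T))), transplanted to defect one; the typed crux
`DefectOneSkinnerWiles` is exactly the claim that evasion (a) survives l₀ = 1.
- Literature.Barriers.Langlands.TaylorWilesNumericalCoincidence: met head-on — F imaginary
quadratic, n = 2 gives `defectGL 0 1 2 = 1`, `CHTCoincidenceGL` fails
(`not_chtCoincidenceGL_of_complexPlace`); the engine is the barrier's recorded evasion,
Calegari–Geraghty/Hansen patching of two-term complexes in degrees [q₀, q₀+1] (CalegariGeraghty2017,
Hansen2012, KhareThorne2017), here performed over the one-dimensional base R^ord/𝔭; the deficit of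
one Taylor–Wiles prime is absorbed by the complex, not denied.
- Literature.Barriers.Langlands.TaylorWilesNumericalCoincidenceNarrow: same; ρ is non-polarizable
(no descent to a unitary group), so the narrow form's polarizable escape is not invoked — the bet is
genuinely pos

Novelty grade: new-combination — ROUTE REVIEW (refuter-rreview-…-f4089ca2-0, 2026-08-15; grade agrees with the card audit). MISSED PRIOR ART ON X ITSELF: Berger–Klosin, J. Inst. Math. Jussieu 8 (2009) doi:10.1017/s1474748009000036 ('we prove the modularity of minimally ramified ORDINARY RESIDUALLY REDUCIBLE p-adic Galois representa (refuter refuter-rreview-route-HubbardSuperconduc-f4089ca2-0, 2026-08-15T11:21:33Z; prior: doi:10.1017/s1474748009000036, doi:10.1007/s00208-012-0793-1, doi:10.1142/s1793042125500228, doi:10.1007/bf02698855, doi:10.1090/jams/991, arXiv:2301.10509)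

History (route lifecycle, newest last):
- 2026-08-15T13:48:41Z · CLOSED retired — not-a-thesis: assembly does not conclude the sub-problem Statement (operator:999:1257524)

sub-problem: Langlands · status: closed(retired) · opened planner-plancard-Langlands-Langlands-eisenste-8ec25c50-0 2026-08-15T10:58:11Z · rev 1 · ledger route-Langlands-EisensteinDefectOne
GENERATED by the gate from the ledger (D-0016/17). Provers cite these decls: `theorem foo : Summit.Langlands.Langlands.Theses.EisensteinDefectOne.<Decl> := …` in Summits/Langlands/Langlands/Theorems/<Name>.lean.
-/

namespace Summit.Langlands.Langlands.Theses.EisensteinDefectOne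

open scoped BigOperators Topology Manifold Classical MeasureTheory ProbabilityTheory Matrix InnerProductSpace ComplexConjugate ContinuousMap
open Filter Set Function TopologicalSpace MeasureTheory

attribute [summit_statement] _root_.Langlands

/-- item stmt-Langlands-1708 · target · rank 0 · closed · moot by None · by planner
why it might fail: Typed sector of Fontaine–Mazur: fails only if FM fails for GL₂ over imaginary quadratic F in the reducible ordinary sector (known so far only in BK09/BK13 minimal, unique-extension cases); typing risk: junk if hypotheses were unsatisfiable (met by 5-isogenous ordinary E/F).
sources: SkinnerWiles1999, arXiv:2301.10509, FontaineMazurGeometric1995, doi:10.1017/s1474748009000036, arXiv:1606.06535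
[target] Thesis X: over an imaginary quadratic F (IsTotallyComplex ∧ finrank ℚ F = 2), p odd, every
continuous irreducible ρ : Γ_F → GL₂(ℚ̄_p), unramified a.e., given with an integral model ρ₀ : Γ_F →
GL₂(𝒪), 𝒪 = valuation ring of ℚ̄_p, that is upper triangular mod 𝔪 (ρ̄^ss = χ̄₁ ⊕ χ̄₂; WLOG by
conjugation, no generality lost) and, at every v ∣ p, p-distinguished (∃ σ ∈ D_v with (ρ₀σ)₀₀ ≢
(ρ₀σ)₁₁ mod 𝔪) and ordinary of regular weight (∃ k ≥ 2, m ≥ 1, Q with Q⁻¹ρ|_{D_v}Q upper triangular,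
lower-right entry an m-torsion character and upper-left entry ε^{k-1}·(m-torsion) on the inertia
group absInertia F_v), is modular: ∃ L-algebraic cuspidal π of GL₂(𝔸_F) with Satake–Frobenius
matching a.e. (shape of Literature FontaineMazurLanglandsGLn, arithmetic Frobenius, m = 1
normalisation). ∀ ι is the strong form (cohomological eigensystems are defined over ℚ̄). Sector of
Summit.Langlands.GaloisToAutomorphic 2 (Satake form; LGC upgrade deferred). Ordinary ⇒ de Rham, so
no PstWeilDeligneData placeholder is touched. Sources: SkinnerWiles1999 (Thm, hypotheses (i)–(iv)
transposed), arXiv:2301.10509 Thm 1.1, FontaineMazurGeometric1995. -/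
@[route_item "route-Langlands-EisensteinDefectOne"]
def ReducibleOrdinaryModular : Prop :=
  ∀ (F : Type) [Field F] [NumberField F], NumberField.IsTotallyComplex F → Module.finrank ℚ F = 2 → ∀ (p : ℕ) [Fact p.Prime], p ≠ 2 → ∀ (O : ValuationSubring (PadicAlgCl p)), O = (Valued.v : Valuation (PadicAlgCl p) NNReal).valuationSubring → ∀ (hcpt : Literature.NumberTheory.Automorphic.isCompact_glFiniteIntegralLevel 2 F) (ι : PadicAlgCl p ≃+* ℂ) (ρ : Literature.NumberTheory.GaloisRepresentations.FramedGaloisRep F (PadicAlgCl p) 2) (ρ₀ : Field.absoluteGaloisGroup F →* Matrix.GeneralLinearGroup (Fin 2) O), ρ.toGaloisRep.IsIrreducible → (∀ᶠ v in cofinite, ρ.IsUnramifiedAt v) → (∀ g, Matrix.GeneralLinearGroup.map O.subtype (ρ₀ g) = ρ g) → (∀ g, (ρ₀ g).val 1 0 ∈ IsLocalRing.maximalIdeal O) → (∀ v : IsDedekindDomain.HeightOneSpectrum (NumberField.RingOfIntegers F), (p : NumberField.RingOfIntegers F) ∈ v.asIdeal → (∃ σ, (ρ₀ (Literature.NumberTheory.GaloisRepresentations.absGaloisRestrict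 F (v.adicCompletion F) σ)).val 0 0 - (ρ₀ (Literature.NumberTheory.GaloisRepresentations.absGaloisRestrict F (v.adicCompletion F) σ)).val 1 1 ∉ IsLocalRing.maximalIdeal O) ∧ (∃ k : ℕ, 2 ≤ k ∧ ∃ m : ℕ, 0 < m ∧ ∃ Q : Matrix.GeneralLinearGroup (Fin 2) (PadicAlgCl p), ∀ σ, (Q⁻¹ * ρ.toLocal v σ * Q).val 1 0 = 0 ∧ (σ ∈ Literature.NumberTheory.GaloisRepresentations.absInertia (v.adicCompletion F) → (Q⁻¹ * ρ.toLocal v σ * Q).val 1 1 ^ m = 1 ∧ (Q⁻¹ * ρ.toLocal v σ * Q).val 0 0 ^ m = algebraMap (Padic p) (PadicAlgCl p) (((Literature.NumberTheory.GaloisRepresentations.GaloisRep.cyclotomicCharacter (v.adicCompletion F) p σ).val : PadicInt p) : Padic p) ^ ((k - 1) * m)))) → ∃ π : Literature.NumberTheory.Automorphic.CuspidalAutomorphicRepData 2 F hcpt, π.1.IsLAlgebraic ∧ (∀ᶠ v in cofinite, ∃ α : Multiset ℂ, π.1.HasSatakeParamAt v α ∧ ρ.IsUnramifiedAt v ∧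 ρ.HasFrobCharpolyAt v (Literature.NumberTheory.Automorphic.arithFrobPolyOfSatake ι v.residueCard 1 α))

/-- item stmt-Langlands-1709 · crux · rank 2 · closed · moot by None · by planner
why it might fail: l₀=1: TW sets one prime short at the nice prime; reducible locus may be full-dimensional and SW's shrinking (solvable base change + Washington's class-group bound, F(χ̄₁/χ̄₂)/ℚ abelian) has no analogue over F (CG17 Rem 5.14; BK F[[X]]-lifts); μ=0 known only for p split (Gillard, Oukhaba–Viguié).
sources: SkinnerWiles1999, CalegariGeraghty2017, Hansen2012, KhareThorne2017, CaraianiNewton2023, arXiv:2301.10509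
[crux] THE ENGINE (card Z1+Z3+Z4; Skinner–Wiles transplanted to l₀ = 1). Same binders/hypotheses as
the target; extra hypothesis = an EISENSTEIN CONGRUENCE SEED of any level: ∃ cuspidal L-algebraic π₀
of GL₂(𝔸_F), an irreducible r : Γ_F → GL₂(ℚ̄_p) Satake-matching π₀ a.e., with an integral model r₀
upper triangular mod 𝔪 whose diagonal is congruent to that of ρ₀ (same ordered residual pair
(χ̄₁,χ̄₂)) and r ordinary of some regular weight at every v ∣ p. Conclusion: ρ is modular. Strictly
weaker than X (X ⇒ this: ignore the seed; checked in Sketch.lean). Intended proof = the card's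
mechanism: nearly-ordinary deformation rings R^ord_𝔻 of the residual extensions over the
3-dimensional Iwasawa algebra Λ_F; bound the reducible locus dim R^red ≤ dim(ordinary components) −
1 directly (no solvable base change: CG Rem 5.14); nice dimension-one primes 𝔭 (ρ_𝔭 irreducible
ordinary p-distinguished over k[[T]]) exist on every large component; the seed's Hida family +
Caraiani–Newton P-ordinary determinants make the Eisenstein maximal ideal of the cuspidal P-ordinary
Hecke algebra proper, Raynaud connectivity makes every nice prime pro-modular;
Calegari–Geraghty/Hansen patching of the two-term P- -/
@[route_item "route-Langlands-EisensteinDefectOne"]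
def DefectOneSkinnerWiles : Prop :=
  ∀ (F : Type) [Field F] [NumberField F], NumberField.IsTotallyComplex F → Module.finrank ℚ F = 2 → ∀ (p : ℕ) [Fact p.Prime], p ≠ 2 → ∀ (O : ValuationSubring (PadicAlgCl p)), O = (Valued.v : Valuation (PadicAlgCl p) NNReal).valuationSubring → ∀ (hcpt : Literature.NumberTheory.Automorphic.isCompact_glFiniteIntegralLevel 2 F) (ι : PadicAlgCl p ≃+* ℂ) (ρ : Literature.NumberTheory.GaloisRepresentations.FramedGaloisRep F (PadicAlgCl p) 2) (ρ₀ : Field.absoluteGaloisGroup F →* Matrix.GeneralLinearGroup (Fin 2) O), ρ.toGaloisRep.IsIrreducible → (∀ᶠ v in cofinite, ρ.IsUnramifiedAt v) → (∀ g, Matrix.GeneralLinearGroup.map O.subtype (ρ₀ g) = ρ g) → (∀ g, (ρ₀ g).val 1 0 ∈ IsLocalRing.maximalIdeal O) → (∀ v : IsDedekindDomain.HeightOneSpectrum (NumberField.RingOfIntegers F), (p : NumberField.RingOfIntegers F) ∈ v.asIdeal → (∃ σ, (ρ₀ (Literature.NumberTheory.GaloisRepresentations.absGaloisRestrict F (v.adicCompletion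 F) σ)).val 0 0 - (ρ₀ (Literature.NumberTheory.GaloisRepresentations.absGaloisRestrict F (v.adicCompletion F) σ)).val 1 1 ∉ IsLocalRing.maximalIdeal O) ∧ (∃ k : ℕ, 2 ≤ k ∧ ∃ m : ℕ, 0 < m ∧ ∃ Q : Matrix.GeneralLinearGroup (Fin 2) (PadicAlgCl p), ∀ σ, (Q⁻¹ * ρ.toLocal v σ * Q).val 1 0 = 0 ∧ (σ ∈ Literature.NumberTheory.GaloisRepresentations.absInertia (v.adicCompletion F) → (Q⁻¹ * ρ.toLocal v σ * Q).val 1 1 ^ m = 1 ∧ (Q⁻¹ * ρ.toLocal v σ * Q).val 0 0 ^ m = algebraMap (Padic p) (PadicAlgCl p) (((Literature.NumberTheory.GaloisRepresentations.GaloisRep.cyclotomicCharacter (v.adicCompletion F) p σ).val : PadicInt p) : Padic p) ^ ((k - 1) * m)))) → (∃ (π₀ : Literature.NumberTheory.Automorphic.CuspidalAutomorphicRepData 2 F hcpt) (r : Literature.NumberTheory.GaloisRepresentations.FramedGaloisRep F (PadicAlgCl p) 2) (r₀ : Field.absoluteGaloisGroup F →* Matrix.GeneralLinearGroup (Fin 2)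 O), π₀.1.IsLAlgebraic ∧ (∀ᶠ v in cofinite, ∃ α : Multiset ℂ, π₀.1.HasSatakeParamAt v α ∧ r.IsUnramifiedAt v ∧ r.HasFrobCharpolyAt v (Literature.NumberTheory.Automorphic.arithFrobPolyOfSatake ι v.residueCard 1 α)) ∧ r.toGaloisRep.IsIrreducible ∧ (∀ g, Matrix.GeneralLinearGroup.map O.subtype (r₀ g) = r g) ∧ (∀ g, (r₀ g).val 1 0 ∈ IsLocalRing.maximalIdeal O ∧ (r₀ g).val 0 0 - (ρ₀ g).val 0 0 ∈ IsLocalRing.maximalIdeal O ∧ (r₀ g).val 1 1 - (ρ₀ g).val 1 1 ∈ IsLocalRing.maximalIdeal O) ∧ (∀ v : IsDedekindDomain.HeightOneSpectrum (NumberField.RingOfIntegers F), (p : NumberField.RingOfIntegers F) ∈ v.asIdeal → (∃ k : ℕ, 2 ≤ k ∧ ∃ m : ℕ, 0 < m ∧ ∃ Q : Matrix.GeneralLinearGroup (Fin 2) (PadicAlgCl p), ∀ σ, (Q⁻¹ * r.toLocal v σ * Q).val 1 0 = 0 ∧ (σ ∈ Literature.NumberTheory.GaloisRepresentations.absInertia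 (v.adicCompletion F) → (Q⁻¹ * r.toLocal v σ * Q).val 1 1 ^ m = 1 ∧ (Q⁻¹ * r.toLocal v σ * Q).val 0 0 ^ m = algebraMap (Padic p) (PadicAlgCl p) (((Literature.NumberTheory.GaloisRepresentations.GaloisRep.cyclotomicCharacter (v.adicCompletion F) p σ).val : PadicInt p) : Padic p) ^ ((k - 1) * m))))) → ∃ π : Literature.NumberTheory.Automorphic.CuspidalAutomorphicRepData 2 F hcpt, π.1.IsLAlgebraic ∧ (∀ᶠ v in cofinite, ∃ α : Multiset ℂ, π.1.HasSatakeParamAt v α ∧ ρ.IsUnramifiedAt v ∧ ρ.HasFrobCharpolyAt v (Literature.NumberTheory.Automorphic.arithFrobPolyOfSatake ι v.residueCard 1 α))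

/-- item stmt-Langlands-1710 · crux · rank 3 · closed · moot by None · by planner
why it might fail: Berger09 Thm 13 gives T/I ↠ O/L^int(0,χ) only for p split, p ∤ h_F·#(O_F/𝔐)^×, split conductor, H²_c torsion-free, and needs p | L^int; forcing it by Eisenstein level raising at one q with torsion Bianchi classes is unproved; inert/ramified p and p=3 have no congruence theorem at all.
sources: doi:10.1112/S0010437X09003984, arXiv:0801.0091, arXiv:1103.5100, arXiv:1606.06535, CaraianiNewton2023, CalegariMazur2008
[crux] THE ENTRANCE (card Z2, output level, LEVEL-CONTROLLED so that it is not implied by X). Same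
binders/hypotheses as the target; conclusion: ∃ cuspidal L-algebraic π₀, irreducible r
Satake-matching π₀ a.e., integral model r₀ upper triangular mod 𝔪 with the SAME ordered residual
diagonal pair as ρ₀, r ordinary of some regular weight k₀ ≥ 2 (any p-power nebentypus) at every v ∣
p, and ONE auxiliary place q such that at every v ∤ p, v ≠ q where χ̄₁ and χ̄₂ are unramified
(global inertia acts trivially mod 𝔪 on the diagonal of ρ₀) both r and π₀ are unramified — an
Eisenstein congruence at optimal level up to one level-raising prime ('every residual Eisenstein
pair arising from the target class is cuspidally, ordinarily modular'). Ribet's lemma makes the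
order of (χ̄₁,χ̄₂) immaterial given irreducibility of r. Intended proof: Eisenstein cohomology of
Bianchi groups for (χ₁,χ₂) (Harder), Berger's lower bound on the Eisenstein ideal index by
L^{alg}(0,χ₁χ₂⁻¹·) (Compositio 145 (2009)), level raising at q with χ̄₁(Frob_q) =
χ̄₂(Frob_q)·Nq^{±1} to force divisibility, ordinarity from the ordinary Eisenstein family in Hida
theory over F; weight freedom k₀ is allowed precisely because paral -/
@[route_item "route-Langlands-EisensteinDefectOne"]
def EisensteinCongruenceSeed : Prop :=
  ∀ (F : Type) [Field F] [NumberField F], NumberField.IsTotallyComplex F → Module.finrank ℚ F = 2 → ∀ (p : ℕ) [Fact p.Prime], p ≠ 2 → ∀ (O : ValuationSubring (PadicAlgCl p)), O = (Valued.v : Valuation (PadicAlgCl p) NNReal).valuationSubring → ∀ (hcpt : Literature.NumberTheory.Automorphic.isCompact_glFiniteIntegralLevel 2 F) (ι : PadicAlgCl p ≃+* ℂ) (ρ : Literature.NumberTheory.GaloisRepresentations.FramedGaloisRep F (PadicAlgCl p) 2) (ρ₀ : Field.absoluteGaloisGroup F →* Matrix.GeneralLinearGroup (Fin 2) O), ρ.toGaloisRep.IsIrreducible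 → (∀ᶠ v in cofinite, ρ.IsUnramifiedAt v) → (∀ g, Matrix.GeneralLinearGroup.map O.subtype (ρ₀ g) = ρ g) → (∀ g, (ρ₀ g).val 1 0 ∈ IsLocalRing.maximalIdeal O) → (∀ v : IsDedekindDomain.HeightOneSpectrum (NumberField.RingOfIntegers F), (p : NumberField.RingOfIntegers F) ∈ v.asIdeal → (∃ σ, (ρ₀ (Literature.NumberTheory.GaloisRepresentations.absGaloisRestrict F (v.adicCompletion F) σ)).val 0 0 - (ρ₀ (Literature.NumberTheory.GaloisRepresentations.absGaloisRestrict F (v.adicCompletion F) σ)).val 1 1 ∉ IsLocalRing.maximalIdeal O) ∧ (∃ k : ℕ, 2 ≤ k ∧ ∃ m : ℕ, 0 < m ∧ ∃ Q : Matrix.GeneralLinearGroup (Fin 2) (PadicAlgCl p), ∀ σ, (Q⁻¹ * ρ.toLocal v σ * Q).val 1 0 = 0 ∧ (σ ∈ Literature.NumberTheory.GaloisRepresentations.absInertia (v.adicCompletion F) → (Q⁻¹ * ρ.toLocal v σ * Q).val 1 1 ^ m = 1 ∧ (Q⁻¹ * ρ.toLocal v σ * Q).val 0 0 ^ m = algebraMap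 (Padic p) (PadicAlgCl p) (((Literature.NumberTheory.GaloisRepresentations.GaloisRep.cyclotomicCharacter (v.adicCompletion F) p σ).val : PadicInt p) : Padic p) ^ ((k - 1) * m)))) → ∃ (π₀ : Literature.NumberTheory.Automorphic.CuspidalAutomorphicRepData 2 F hcpt) (r : Literature.NumberTheory.GaloisRepresentations.FramedGaloisRep F (PadicAlgCl p) 2) (r₀ : Field.absoluteGaloisGroup F →* Matrix.GeneralLinearGroup (Fin 2) O) (q : IsDedekindDomain.HeightOneSpectrum (NumberField.RingOfIntegers F)), π₀.1.IsLAlgebraic ∧ (∀ᶠ v in cofinite, ∃ α : Multiset ℂ, π₀.1.HasSatakeParamAt v α ∧ r.IsUnramifiedAt v ∧ r.HasFrobCharpolyAt v (Literature.NumberTheory.Automorphic.arithFrobPolyOfSatake ι v.residueCard 1 α)) ∧ r.toGaloisRep.IsIrreducible ∧ (∀ g, Matrix.GeneralLinearGroup.map O.subtype (r₀ g) = r g) ∧ (∀ g, (r₀ g).val 1 0 ∈ IsLocalRing.maximalIdeal O ∧ (r₀ g).val 0 0 - (ρ₀ g).val 0 0 ∈ IsLocalRing.maximalIdeal O ∧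 (r₀ g).val 1 1 - (ρ₀ g).val 1 1 ∈ IsLocalRing.maximalIdeal O) ∧ (∀ v : IsDedekindDomain.HeightOneSpectrum (NumberField.RingOfIntegers F), (p : NumberField.RingOfIntegers F) ∈ v.asIdeal → (∃ k : ℕ, 2 ≤ k ∧ ∃ m : ℕ, 0 < m ∧ ∃ Q : Matrix.GeneralLinearGroup (Fin 2) (PadicAlgCl p), ∀ σ, (Q⁻¹ * r.toLocal v σ * Q).val 1 0 = 0 ∧ (σ ∈ Literature.NumberTheory.GaloisRepresentations.absInertia (v.adicCompletion F) → (Q⁻¹ * r.toLocal v σ * Q).val 1 1 ^ m = 1 ∧ (Q⁻¹ * r.toLocal v σ * Q).val 0 0 ^ m = algebraMap (Padic p) (PadicAlgCl p) (((Literature.NumberTheory.GaloisRepresentations.GaloisRep.cyclotomicCharacter (v.adicCompletion F) p σ).val : PadicInt p) : Padic p) ^ ((k - 1) * m)))) ∧ (∀ v : IsDedekindDomain.HeightOneSpectrum (NumberField.RingOfIntegers F), v ≠ q → (p : NumberField.RingOfIntegers F) ∉ v.asIdeal → (∀ 𝔓 ∈ v.primesAbove, ∀ σ ∈ 𝔓.inertia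 (Field.absoluteGaloisGroup F), (ρ₀ σ).val 0 0 - 1 ∈ IsLocalRing.maximalIdeal O ∧ (ρ₀ σ).val 1 1 - 1 ∈ IsLocalRing.maximalIdeal O) → r.IsUnramifiedAt v ∧ π₀.1.IsUnramifiedAt v)

/-- item stmt-Langlands-1711 · support · rank 9 · closed · moot by None · by planner
why it might fail: Glue only: fails if a Target hypothesis is mis-typed for rho_{E,5} (e.g. ordinary shape when 5 ramifies in F) - then restate the Target, not the corollary.
sources: arXiv:2301.10509, SilvermanAEC2009, ACCGHLNSTT2023
[support] HEADLINE COROLLARY (glue, does not drive staffing): X ⇒ every elliptic curve E over an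
imaginary quadratic F (integral model over 𝓞_F, Δ ≠ 0, no geometric CM) with an F-rational 5-isogeny
(a nonzero Γ_F-stable-up-to-scalar 5-torsion geometric point) and good ORDINARY reduction of the
model at every v ∣ 5 (Δ(E mod v) ≠ 0 and 5 ∤ a_v) is modular: ∃ L-algebraic cuspidal π of GL₂(𝔸_F)
with Σ α_j⁻¹ = a_w(E), Π α_j⁻¹ = N w at almost all w (arithmetic-Frobenius charpoly X² − a_w X + N w
of V_5E; lang.S28 shape with L = F, no base change). Proof plan: frame V_5E ⊗ ℚ̄_5 (basis of T_5E
adapted to the isogeny kernel ⇒ ρ₀ upper triangular mod 5); irreducible by Faltings (non-CM);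
unramified a.e.; ordinary shape k = 2, m = 1 at v ∣ 5 from the connected–étale sequence of E[5^∞]
(height-one formal group ⇒ inertia acts by ε on T_5Ê, trivially on the étale quotient);
p-DISTINGUISHED IS AUTOMATIC for p = 5: χ̄₁χ̄₂ = ω and {χ̄ᵢ|D_v} = {ωψ⁻¹, ψ} with ψ unramified,
equality would force ω|_{I_v} = 1, impossible since e(F_v/ℚ₅) ≤ 2 < 4 = e(ℚ₅(ζ₅)/ℚ₅). This is the
population Caraiani–Newton's hypothesis 'X₀(15)(F) finite' omits (rank-one F-points of X₀(15) give
infinitely many 15-isogenous E/F); -/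
@[route_item "route-Langlands-EisensteinDefectOne"]
def FiveIsogenyEllipticCurves : Prop :=
  ReducibleOrdinaryModular → ∀ (F : Type) [Field F] [NumberField F], NumberField.IsTotallyComplex F → Module.finrank ℚ F = 2 → ∀ (E : WeierstrassCurve (NumberField.RingOfIntegers F)), E.Δ ≠ 0 → ¬ (E.baseChange F).HasCM → (∃ P : (E.baseChange F).geomPoints, P ≠ 0 ∧ (5 : ℕ) • P = 0 ∧ ∀ σ : Field.absoluteGaloisGroup F, ∃ a : ℕ, σ • P = a • P) → (∀ v : IsDedekindDomain.HeightOneSpectrum (NumberField.RingOfIntegers F), (5 : NumberField.RingOfIntegers F) ∈ v.asIdeal → (E.map (Ideal.Quotient.mk v.asIdeal)).Δ ≠ 0 ∧ ¬ ((5 : ℤ) ∣ Literature.NumberTheory.Automorphic.frobTraceAt E v)) → ∃ (hcpt : Literature.NumberTheory.Automorphic.isCompact_glFiniteIntegralLevel 2 F) (π : Literature.NumberTheory.Automorphic.CuspidalAutomorphicRepData 2 F hcpt), π.1.IsLAlgebraic ∧ ∀ᶠ w in cofinite, ∃ α : Multiset ℂ, π.1.HasSatakeParamAt w α ∧ (α.map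 fun a => a⁻¹).sum = (Literature.NumberTheory.Automorphic.frobTraceAt E w : ℂ) ∧ (α.map fun a => a⁻¹).prod = (w.residueCard : ℂ)

/-- item stmt-Langlands-2586 · support · rank 9 · open · by planner
[support] needs-fact (route-repair 2026-08-15, cone guardrail): the named fact
`Literature.NumberTheory.Automorphic.exists_galoisRep_of_regularAlgebraic` — Galois representations
attached to REGULAR algebraic cuspidal π of GL_n over totally real / CM fields with unramified
compatibility at every unramified v ∤ ℓ (HarrisLanTaylorThorneRMS2016 Thm. A; Scholze2015 Thm. 1.0.4
/ Cor. V.4.2; VarmaFMS2024 Thm. 1). This is the one cone fact on the Galois side that route CMFern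
genuinely rests on: it is the regular-weight sector of AutToGalCM (rank 3) and supplies the branches
ρ_{π_m} of FernDensity (rank 2). Tier-0 cone debt: it closes by the Literature theorem
`exists_galoisRep_of_regularAlgebraic_holds` once a provefact seat lands it (conditional reductions
already in tree: ReciprocityGLnProofs `exists_galoisRep_of_regularAlgebraic_of`,
ReciprocityGLnCor93Proofs); do NOT attempt it directly from this route. Not one of the route's
cruxes (a published theorem, size XL). -/
@[route_item "route-Langlands-EisensteinDefectOne"]
def GaloisRepOfRegularAlgebraic : Prop :=
  Literature.NumberTheory.Automorphic.exists_galoisRep_of_regularAlgebraic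

/-- item stmt-Langlands-3246 · support · rank 9 · closed · moot by None · by planner
[support] CLOSURE GLUE + needs-fact marker (route-repair 2026-08-15, Phase C cone guardrail). The
Borel–Jacquet 4.6 bridge `AutomorphicRepsGL.exists_cuspidalRepData_of_L2`, closed over all (n, K,
hcpt, μ): every irreducible closed Π ≤ L²_cusp(GL_n(K)\GL_n(𝔸_K)/A_G, μ) is realised by a cuspidal
datum π (W' = ⊥, IsAssociatedL2 π Π). Why this route wants it: the Assembly ends in `∃ π :
CuspidalAutomorphicRepData 2 F hcpt, …`; whatever proves DefectOneSkinnerWiles (R = T in P-ordinary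
Bianchi cohomology) outputs a cuspidal Hecke eigensystem / L²-cuspidal representation, and the LAST
step — producing the datum with its Satake parameters — is this fact (then
`hasSatakeParamAt_iff_L2`), or alternatively BJ 4.3 `automorphicForms_isStableSubmodule` if the
datum W is built by hand from a cusp form. Summit-generic: every (B)-direction statement typed over
CuspidalAutomorphicRepData needs one of the two; filed once here so it dedups. It is a published
theorem (BorelJacquet1979 4.4–4.6, Gelfand–Graev–Piatetski-Shapiro 1969 Ch. 3), size XL; closes when
the Literature fact is discharged; do not attempt from this route. Why it might fail: only
mis-typing of the bridge (formsOfL2 / IsAssociatedL2 c -/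
@[route_item "route-Langlands-EisensteinDefectOne"]
def CuspidalDatumOfL2 : Prop :=
  ∀ (n : ℕ) (K : Type) [Field K] [NumberField K] (hcpt : Literature.NumberTheory.Automorphic.isCompact_glFiniteIntegralLevel n K) (μ : MeasureTheory.Measure (Literature.NumberTheory.Automorphic.AdelicGroupData.gl n K).automorphicQuotient) [(Literature.NumberTheory.Automorphic.AdelicGroupData.gl n K).IsAutomorphicMeasure μ], Literature.NumberTheory.Automorphic.AutomorphicRepsGL.exists_cuspidalRepData_of_L2 hcpt μ

/-- item stmt-Langlands-1712 · assembly · rank 1 · closed · moot by None · by planner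
sources: SkinnerWiles1999
[assembly] EisensteinCongruenceSeed → DefectOneSkinnerWiles → ReducibleOrdinaryModular: given an
admissible ρ, the seed crux supplies (π₀, r, r₀, q, …); forget q and the level control; feed the
engine crux. Term proof checked in the planner's Sketch.lean (intro …; refine hSW … ?_; obtain ⟨π₀,
r, r₀, q, hA, hB, hC, hD, hE, hF, hG⟩ := hS …; exact ⟨π₀, r, r₀, hA, hB, hC, hD, hE, hF⟩). The
assembly ends in the sector target X, not in `Langlands`: no single sector implies the summit; X is
the residually-reducible ordinary conjunct of direction (B), n = 2, F imaginary quadratic, in Satake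
form. -/
@[route_item "route-Langlands-EisensteinDefectOne"]
def Assembly : Prop :=
  EisensteinCongruenceSeed → DefectOneSkinnerWiles → ReducibleOrdinaryModular

end Summit.Langlands.Langlands.Theses.EisensteinDefectOne
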